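import Summits.BirchSwinnertonDyer.BirchSwinnertonDyer.Theorems.KimAtThreeKolyvaginDeepLowerOfCertificate
import HarnessLib

/-!
# Route `KimAtThreeKolyvagin` (rung W2): MINIMAL certificates — crux `DeepLowerAtThree` from bounds at first-non-vanishing levels

Third file of the `∂`-functional ⟺ certificate dictionary (after `KimAtThreeKolyvaginCertificateDictionary`
and `KimAtThreeKolyvaginDeepLowerOfCertificate`). The END theorems of cell n1011's sub-route (a′)
(`GaloisImage/KuriharaLowerBoundThree*`: `Assembly.padicValRat_le_of_certificate`,
`Assembly.padicValRat_le_of_kolyvaginProduct{,_deep}`) read a certificate `δ̃_n ≢ 0 (mod 3^j)` ONLY at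
a level all of whose proper non-empty sub-levels are `3^j`-divisible (the first non-vanishing level of
the derived system — Kim, AJM 148 Thm. 1.9 (6) / Thm. 3.13). This file closes the purely
combinatorial gap between that shape and the crux:
* `isCyclicKolyvaginLevel_of_dvd` — cyclic Kolyvagin levels are closed under divisors;
* `ne_zero_of_not_kuriharaDivisibleAt` — a certificate lives at a genuine level (`n ≠ 0`);
* **`exists_minimal_certificate`** (general `p`): a certificate of depth `j` at a level `n ≠ 1`
  descends to a divisor `c ∣ n`, `c ≠ 1`, carrying a certificate of the same depth all of whose
  divisors `d ∉ {1, c}` are `p^j`-divisible (well-foundedness of `ℕ`; the sub-levels of a level of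
  depth `k` are levels of depth `k`);
* **`uniformCertificateBound_of_minimal`** (general `p`, one row): if the bound `∂⁽⁰⁾(δ̃) ≤ s + j`
  holds for every MINIMAL certificate of depth `j + 1` at cyclic levels `c ≠ 1` of depth `k ≥ K + j`,
  it holds for EVERY certificate of depth `j + 1` at depth `k ≥ K + j` (at `n = 1` the certificate IS
  the bound: `∂⁽⁰⁾ = ord δ̃_1 ≤ j`);
* **`deepLowerAtThree_of_minimalCertificateBound`**: hence the uniform MINIMAL-certificate statement
  (the exact shape n1011's END theorems conclude, in the `f`-currency) implies crux `DeepLowerAtThree`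
  (item 19075) outright, through `deepLowerAtThree_of_uniformCertificateBound`.
Nothing is asserted; the minimal-certificate statement is an inline hypothesis, not a tree fact.
[cite: Kim2022StructureSelmer, Thm. 1.9 (6), Thm. 3.13, §1.5.1 (PDF p. 7)] [cite: MazurRubin2004, Thm. 5.2.12, Cor. 5.2.13]
[cite: Kim2025RefinedTNC, Thm 1.1]
-/

set_option autoImplicit false
-- the Theorems namespace of a single-conjunct summit repeats the summit name by design (D-0017)
set_option linter.dupNamespace false

noncomputable section

open scoped MatrixGroups ModularForm Classical

open CongruenceSubgroup WeierstrassCurve Literature.NumberTheory.EllipticCurves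
  Literature.NumberTheory.EllipticCurves.ModularForms

namespace Summit.BirchSwinnertonDyer.BirchSwinnertonDyer.Theorems.KimAtThreeKolyvaginMinimalCertificate

open Summit.BirchSwinnertonDyer.Rank1Residual.Additive
open Summit.BirchSwinnertonDyer.BirchSwinnertonDyer.Theses.KimAtThreeKolyvagin
open Summit.BirchSwinnertonDyer.BirchSwinnertonDyer.Theorems.KimAtThreeKolyvaginDeepUpperRung
open Summit.BirchSwinnertonDyer.BirchSwinnertonDyer.Theorems.KimAtThreeKolyvaginUnitLevelOneRungs
open Summit.BirchSwinnertonDyer.BirchSwinnertonDyer.Theorems.KimAtThreeKolyvaginCertificateDictionary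
open Summit.BirchSwinnertonDyer.BirchSwinnertonDyer.Theorems.KimAtThreeKolyvaginDeepLowerOfCertificate

/-! ### Minimal certificates (general `p`) -/

section Minimal

variable (W : WeierstrassCurve ℚ) [W.IsGloballyMinimal] (p : ℕ) {N : ℕ} (f : CuspForm (Gamma0 N) 2)

/-- Cyclic Kolyvagin levels are closed under divisors (a divisor of `n ∈ 𝒩_1` is in `𝒩_1`, and its
prime factors are prime factors of `n`). [cite: Kim2022StructureSelmer, §1.2.2 and §1.4.2] -/
theorem isCyclicKolyvaginLevel_of_dvd {n c : ℕ} (hn : IsCyclicKolyvaginLevel W p n) (hc : c ∣ n) :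
    IsCyclicKolyvaginLevel W p c :=
  ⟨hn.1.of_dvd hc, fun ℓ _ hℓ => hn.2 ℓ (hℓ.trans hc)⟩

/-- A certificate lives at a genuine level: `δ̃_0` is divisible by everything (`0 ∉ 𝒩_k`), so
`¬ KuriharaDivisibleAt _ _ _ n j` forces `n ≠ 0`. [folklore] -/
theorem ne_zero_of_not_kuriharaDivisibleAt {n j : ℕ} (h : ¬ KuriharaDivisibleAt W p f n j) : n ≠ 0 := by
  intro hn
  subst hn
  exact h fun k _ hk => absurd hk.squarefree not_squarefree_zero

/-- **Minimal certificates exist.** A certificate of depth `j` (`δ̃_n ∉ p^j ℤ_p/I_n`) at a level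
`n ≠ 1` descends to a divisor `c ∣ n`, `c ≠ 1`, which carries a certificate of depth `j` and ALL of
whose divisors `d ∉ {1, c}` are `p^j`-divisible — the first non-vanishing level of Kim's induction
(AJM 148, proof of Thm. 1.9 (6) / Thm. 3.13). Proof: the least such divisor (`Nat.find`).
[cite: Kim2022StructureSelmer, Thm. 1.9 (6) and Thm. 3.13] -/
theorem exists_minimal_certificate {n j : ℕ} (h : ¬ KuriharaDivisibleAt W p f n j) (hn1 : n ≠ 1) :
    ∃ c, c ∣ n ∧ c ≠ 1 ∧ ¬ KuriharaDivisibleAt W p f c j ∧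
      ∀ d, d ∣ c → d ≠ 1 → d ≠ c → KuriharaDivisibleAt W p f d j := by
  classical
  have hex : ∃ c, c ∣ n ∧ c ≠ 1 ∧ ¬ KuriharaDivisibleAt W p f c j := ⟨n, dvd_rfl, hn1, h⟩
  obtain ⟨hcn, hc1, hcert⟩ := Nat.find_spec hex
  refine ⟨Nat.find hex, hcn, hc1, hcert, fun d hd hd1 hdc => ?_⟩
  by_contra hdiv
  have hc0 : Nat.find hex ≠ 0 := ne_zero_of_not_kuriharaDivisibleAt W p f hcert
  have hlt : d < Nat.find hex :=
    lt_of_le_of_ne (Nat.le_of_dvd (Nat.pos_of_ne_zero hc0) hd) hdc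
  exact Nat.find_min hex hlt ⟨hd.trans hcn, hd1, hdiv⟩

/-- **Bounds at MINIMAL certificates suffice** (one row, general `p`, any `s K : ℕ`). If
`∂⁽⁰⁾(δ̃) ≤ s + j` holds whenever a cyclic level `c ≠ 1` of depth `k ≥ K + j` carries a certificate of
depth `j + 1` all of whose divisors `d ∉ {1, c}` are `p^{j+1}`-divisible, then it holds for EVERY
certificate of depth `j + 1` at every cyclic level of depth `k ≥ K + j`: at `n = 1` the certificate
reads `∂⁽⁰⁾ = ord δ̃_1 ≤ j` directly (`kuriharaPartial_zero`, `kuriharaDivIndex_le_coe_iff`); at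
`n ≠ 1` descend to a minimal certificate (`exists_minimal_certificate`; sub-levels of a level of
depth `k` have depth `k`). [cite: Kim2022StructureSelmer, Thm. 1.9 (6), §1.5.1 (PDF p. 7)] -/
theorem uniformCertificateBound_of_minimal (s K : ℕ)
    (hmin : ∀ j k c : ℕ, K + j ≤ k → IsCyclicKolyvaginLevel W p c → Kato.IsKolyvaginProduct W p k c →
      c ≠ 1 → ¬ KuriharaDivisibleAt W p f c (j + 1) →
      (∀ d, d ∣ c → d ≠ 1 → d ≠ c → KuriharaDivisibleAt W p f d (j + 1)) →
        kuriharaPartial W p f 0 ≤ ((s + j : ℕ) : ℕ∞)) :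
    ∀ j k n : ℕ, K + j ≤ k → IsCyclicKolyvaginLevel W p n → Kato.IsKolyvaginProduct W p k n →
      ¬ KuriharaDivisibleAt W p f n (j + 1) → kuriharaPartial W p f 0 ≤ ((s + j : ℕ) : ℕ∞) := by
  intro j k n hk hn hkn hcert
  by_cases hn1 : n = 1
  · subst hn1
    rw [kuriharaPartial_zero]
    exact ((kuriharaDivIndex_le_coe_iff W p f 1 j).mpr hcert).trans (by exact_mod_cast Nat.le_add_left j s)
  · obtain ⟨c, hcn, hc1, hc, hmin'⟩ := exists_minimal_certificate W p f hcert hn1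
    exact hmin j k c hk (isCyclicKolyvaginLevel_of_dvd W p hn hcn) (hkn.of_dvd hcn) hc1 hc hmin'

end Minimal

/-! ### Crux `DeepLowerAtThree` from the MINIMAL-certificate statement -/

/-- **The uniform MINIMAL-certificate bound implies crux `DeepLowerAtThree`.** Hypothesis `H` (inline,
NOT a tree fact; the `f`-currency shape of the conclusion of n1011's (a′) END theorems
`Assembly.padicValRat_le_of_kolyvaginProduct{,_deep}` / the cell memo's Cor C-t, §16): on every row
of the crux there is a depth threshold `K` such that a certificate of depth `j + 1` at a cyclic level
`c ≠ 1` of depth `k ≥ K + j`, all of whose divisors `d ∉ {1, c}` are `3^{j+1}`-divisible, forces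
`∂⁽⁰⁾(δ̃) ≤ ord₃ #Ш(E/ℚ)(3) + j`. Then `DeepLowerAtThree` (`uniformCertificateBound_of_minimal` +
`deepLowerAtThree_of_uniformCertificateBound`). [cite: Kim2025RefinedTNC, Thm 1.1]
[cite: Kim2022StructureSelmer, Thm. 1.9 (6), Thm. 3.13] [cite: MazurRubin2004, Thm. 5.2.12, Cor. 5.2.13] -/
theorem deepLowerAtThree_of_minimalCertificateBound
    (H : ∀ (W : WeierstrassCurve ℚ) [W.IsElliptic] [W.IsGloballyMinimal],
      (∀ n : ℕ, W.HasSurjectiveModNGaloisRep (3 ^ n : ℕ)) → Finite W.sha →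
      ∀ {N : ℕ} [NeZero N] (f : CuspForm (Gamma0 N) 2), IsNewformOf W f →
      (∀ r : ℚ, ratPlusSymbol f r ≠ 0 → 0 ≤ padicValRat 3 (ratPlusSymbol f r)) →
      kuriharaVanishingOrder W 3 f = 0 →
      ∃ K : ℕ, ∀ j k c : ℕ, K + j ≤ k → IsCyclicKolyvaginLevel W 3 c →
        Kato.IsKolyvaginProduct W 3 k c → c ≠ 1 → ¬ KuriharaDivisibleAt W 3 f c (j + 1) →
        (∀ d, d ∣ c → d ≠ 1 → d ≠ c → KuriharaDivisibleAt W 3 f d (j + 1)) →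
          kuriharaPartial W 3 f 0 ≤
            ((padicValNat 3 (Nat.card (AddCommGroup.primaryComponent W.sha 3)) + j : ℕ) : ℕ∞)) :
    DeepLowerAtThree := by
  refine deepLowerAtThree_of_uniformCertificateBound fun W _ _ htower hfin N _ f hf hint hord => ?_
  obtain ⟨K, hK⟩ := H W htower hfin f hf hint hord
  exact ⟨K, uniformCertificateBound_of_minimal W 3 f _ K hK⟩

/-! ### Crux `DeepLowerAtThree` on a parametrised row from a bound in END-THEOREM shape (same `ψ`, sub-level vanishing) -/


/-- **From a minimal certificate to the END-theorem certificate shape.** A certificate of depth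
`j + 1` at a cyclic level `c ≠ 1` of depth `k`, all of whose divisors `d ∉ {1, c}` are
`p^{j+1}`-divisible, yields ONE modulus `1 ≤ k' ≤ j + 1` with `c ∈ 𝒩_{k'}`, ONE system `ψ` of
surjective discrete logarithms mod `p^{k'}` with `kuriharaNumber f (p^{k'}) c ψ ≠ 0`, and the vanishing
of `kuriharaNumber f (p^{k'}) d ψ` for every divisor `1 < d < c` (the SAME `ψ`; `d ∈ 𝒩_{k'}` as a
divisor) — exactly the certificate block of cell n1011's END theorems
`GaloisImage.Assembly.padicValRat_le_of_kolyvaginProduct{,_deep}`. [cite: Kim2022StructureSelmer, Thm. 1.9 (6), Thm. 3.13] -/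
theorem exists_endShape_of_minimal_certificate (W : WeierstrassCurve ℚ) [W.IsGloballyMinimal] (p : ℕ)
    {N : ℕ} (f : CuspForm (Gamma0 N) 2) {c j : ℕ} (hcert : ¬ KuriharaDivisibleAt W p f c (j + 1))
    (hmin : ∀ d, d ∣ c → d ≠ 1 → d ≠ c → KuriharaDivisibleAt W p f d (j + 1)) :
    ∃ k', 1 ≤ k' ∧ k' ≤ j + 1 ∧ ∃ hk' : Kato.IsKolyvaginProduct W p k' c,
      ∃ ψ : (ℓ : ℕ) → (ZMod ℓ)ˣ →* Multiplicative (ZMod (p ^ k')),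
        (∀ ℓ ∈ c.primeFactors, Function.Surjective (ψ ℓ)) ∧
        (haveI : NeZero c := ⟨hk'.ne_zero⟩; kuriharaNumber f (p ^ k') c ψ ≠ 0) ∧
        ∀ d : ℕ, d ∣ c → 1 < d → d < c → ∀ [NeZero d], kuriharaNumber f (p ^ k') d ψ = 0 := by
  obtain ⟨k', hk'1, hk'j, hk', ψ, hψ, hne⟩ :=
    exists_kuriharaNumber_ne_zero_of_not_kuriharaDivisibleAt W p f hcert
  refine ⟨k', hk'1, hk'j, hk', ψ, hψ, hne, fun d hd h1d hdc _ => ?_⟩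
  have hdiv := hmin d hd (by omega) hdc.ne
  have hψd : ∀ ℓ ∈ d.primeFactors, Function.Surjective (ψ ℓ) := fun ℓ hℓ =>
    hψ ℓ (Nat.primeFactors_mono hd hk'.ne_zero hℓ)
  exact hdiv k' hk'j (hk'.of_dvd hd) ψ hψd

/-- **Crux `DeepLowerAtThree` on a parametrised row from a bound in END-THEOREM SHAPE.** For a tower
row with `Ш(E/ℚ)` finite, a parametrisation datum `D`, the `3`-adic period transfer and `ord(δ̃) = 0`,
suppose `hEnd`: for every modulus `1 ≤ j'`, every depth `L` with `K + j' ≤ L + 1` and every cyclic level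
`n ∈ 𝒩_L(E,3)`, ONE system `ψ` with `kuriharaNumber D.f (3^{j'}) n ψ ≠ 0` whose proper divisors
`1 < d < n` have `kuriharaNumber D.f (3^{j'}) d ψ = 0` gives `∃ q, L(E,1)/Ω(W) = q ∧ ord₃ q ≤
ord₃ #Ш(E/ℚ)(3) + (j' − 1)` — the conclusion block of cell n1011's (a′) END theorem
`GaloisImage.Assembly.padicValRat_le_of_kolyvaginProduct_deep` (there `K = 2t + 1` with `#E(ℚ₃)[3] = 3^t`,
class exponent `c = k + t`, `htj : t + j' ≤ k + 1`; its cyclicity flag is spelled on `W.reductionAt v`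
and its remaining ~35 binders are the cell's typed inputs). THEN the conclusion of `DeepLowerAtThree`
holds for `(W, D.f)`: minimal-certificate descent (`uniformCertificateBound_of_minimal`,
`exists_endShape_of_minimal_certificate`), the reverse bridge, and
`deepLower_conclusion_iff_eventuallyDivisible`. Nothing is asserted: `hEnd` is a hypothesis.
[cite: Kim2022StructureSelmer, Thm. 1.9 (6), Thm. 3.13] [cite: Kim2025RefinedTNC, Thm 1.1]
[cite: MazurRubin2004, Thm. 5.2.12, Cor. 5.2.13] -/
theorem deepLower_datum_of_endShapeBound
    (W : WeierstrassCurve ℚ) [W.IsElliptic] [W.IsGloballyMinimal]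
    (htower : ∀ n : ℕ, W.HasSurjectiveModNGaloisRep (3 ^ n : ℕ))
    {N : ℕ} [NeZero N] (D : ModularParametrizationData W N)
    (hper : ∃ u : ℚ, ‖(u : ℚ_[3])‖ = 1 ∧ W.realPeriodRat = u * plusPeriod D.f)
    (hord : kuriharaVanishingOrder W 3 D.f = 0) (K : ℕ)
    (hEnd : ∀ (j' L n : ℕ), 1 ≤ j' → K + j' ≤ L + 1 → IsCyclicKolyvaginLevel W 3 n →
      ∀ hL : Kato.IsKolyvaginProduct W 3 L n,
      ∀ ψ : (ℓ : ℕ) → (ZMod ℓ)ˣ →* Multiplicative (ZMod (3 ^ j')),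
        (∀ ℓ ∈ n.primeFactors, Function.Surjective (ψ ℓ)) →
        (haveI : NeZero n := ⟨hL.ne_zero⟩; kuriharaNumber D.f (3 ^ j') n ψ ≠ 0) →
        (∀ d : ℕ, d ∣ n → 1 < d → d < n → ∀ [NeZero d], kuriharaNumber D.f (3 ^ j') d ψ = 0) →
        ∃ q : ℚ, W.entireLFunction 1 / (W.realPeriodRat : ℂ) = (q : ℂ) ∧
          padicValRat 3 q ≤
            (padicValNat 3 (Nat.card (AddCommGroup.primaryComponent W.sha 3)) : ℤ) + ((j' - 1 : ℕ) : ℤ)) :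
    ∃ d : ℕ, kuriharaPartialDeepInfty W 3 D.f = d ∧
      kuriharaPartial W 3 D.f 0 ≤
        ((padicValNat 3 (Nat.card (AddCommGroup.primaryComponent W.sha 3)) + d : ℕ) : ℕ∞) := by
  haveI : Fact (Nat.Prime 3) := ⟨Nat.prime_three⟩
  set s := padicValNat 3 (Nat.card (AddCommGroup.primaryComponent W.sha 3)) with hs
  have hirr : W.HasIrreducibleModPGaloisRep 3 :=
    hasIrreducibleModPGaloisRep_of_hasSurjectiveModNGaloisRep W 3 (by simpa using htower 1)
  have h0 : ratPlusSymbol D.f 0 ≠ 0 :=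
    ratPlusSymbol_zero_ne_zero_of_kuriharaVanishingOrder_eq_zero W 3 D.f hord
  have hfin0 : kuriharaPartial W 3 D.f 0 < ⊤ := by
    rw [kuriharaPartial_zero]
    exact kuriharaDivIndex_one_lt_top_of_kuriharaVanishingOrder_eq_zero W 3 D.f hord
  obtain ⟨a, ha⟩ : ∃ a : ℕ, kuriharaPartial W 3 D.f 0 = a :=
    (ENat.ne_top_iff_exists.mp hfin0.ne).imp fun a h => h.symm
  -- the uniform bound at every certificate, from the END-shape bound at minimal certificates
  have hunif : ∀ j k n : ℕ, K + j ≤ k → IsCyclicKolyvaginLevel W 3 n →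
      Kato.IsKolyvaginProduct W 3 k n → ¬ KuriharaDivisibleAt W 3 D.f n (j + 1) →
        kuriharaPartial W 3 D.f 0 ≤ ((s + j : ℕ) : ℕ∞) := by
    refine uniformCertificateBound_of_minimal W 3 D.f s K fun j k c hk hc hkc _ hcert hmin => ?_
    obtain ⟨k', hk'1, hk'j, hk', ψ, hψ, hne, hv⟩ :=
      exists_endShape_of_minimal_certificate W 3 D.f hcert hmin
    obtain ⟨q, hq, hle⟩ := hEnd k' k c hk'1 (by omega) hc hkc ψ hψ hne hv
    have hle' : padicValRat 3 q ≤ ((s + j : ℕ) : ℤ) := by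
      have : ((k' - 1 : ℕ) : ℤ) ≤ (j : ℤ) := by exact_mod_cast (show k' - 1 ≤ j by omega)
      push_cast at hle ⊢
      linarith
    exact kuriharaPartial_zero_le_natCast_of_padicValRat_le W 3 D.f (by norm_num) hirr D.isNewformOf h0
      hper hq hle'
  refine (deepLower_conclusion_iff_eventuallyDivisible W 3 D.f ha s).mpr ⟨?_, fun i j hj => ?_⟩
  · exact lt_of_le_of_lt (kuriharaPartialDeepInfty_le_kuriharaPartial_zero W 3 D.f) hfin0
  · refine ⟨K + j, fun n hn hkn _ => ?_⟩
    by_contra hcert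
    have h' := hunif j (K + j) n le_rfl hn hkn hcert
    rw [ha] at h'
    have h'' : a ≤ s + j := by exact_mod_cast h'
    omega

end Summit.BirchSwinnertonDyer.BirchSwinnertonDyer.Theorems.KimAtThreeKolyvaginMinimalCertificate

end
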